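import Literature.MathematicalPhysics.QuantumFieldTheory.CharacterActionPolymers
import HarnessLib

/-!
# Polymer activities of a general `SU(2)` plaquette weight with a centre twist; even/odd parts under the centre

Topic `Literature/MathematicalPhysics/QuantumFieldTheory`; vocabulary of `CharacterActionPolymers.lean` (`linkRel`,
`torusPolymers`, `sheetAt`), `TomboulisVortexDecimation.lean` / `VortexTwistCohomology.lean` (namespace `Tomboulis2007`:
`SU2`, `negOne`, `plaqFn`, `plaqFnTwist`, `torusZtw`) and `ConstructiveQFTWave0.lean` (`GaugeConfig`, `Plaquette`,
`plaquetteHolonomy`, `haarProbability`). DEFINITIONS with elementary API; no fact, nothing asserted about convergence.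

The strong-coupling polymer expansion of the vortex free energy (E. T. Tomboulis, arXiv:0707.2179 [Tomboulis2007Confinement]
§6.2 (6.5)–(6.10); K. R. Ito, E. Seiler, arXiv:0803.3019 [ItoSeiler2008Further] Thm 2.2 (1): for `G = SU(2)` and small `β`
the vortex free energy of WILSON's action obeys the area decay law, "a standard result of the convergent high-temperature
expansion"; G. Münster, Nucl. Phys. B180 (1981) 23; K. Osterwalder, E. Seiler, Ann. Phys. 110 (1978) 440 §3) uses only
two properties of the plaquette weight `w`: `sup |w - 1|` is small, and the twist replaces `w(U_p)` by `w(-U_p)` on the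
twisted plaquettes. This file sets up the expansion for an ARBITRARY weight `w : SU(2) → ℝ` (the character action
`plaqFn J c` of `CharacterActionPolymers.lean` and Wilson's weight `wilsonWeight β = exp(β Re tr ·)` of
`TomboulisConfinementClaim.lean` being the two instances of interest):

* `weightActivity w V U p` — the activity `w^{(V)}(U_p) - 1` (`w(-U_p) - 1` on `p ∈ V`, `w(U_p) - 1` off `V`);
  `weightActivity_plaqFn : weightActivity (plaqFn J c) = plaqActivity J c` (T07 (4.4): `f(-U) = f⁻(U)`);
* `weightPolymerActivity w V X` — the polymer activity `z^{(V)}(X) = ∫ ∏_{p∈X} (w^{(V)}(U_p) - 1) ∏_b dU_b` (complex; `0`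
  off polymers), T07 (6.6);
* `weightZ d L w V` — the twisted partition function `∫ ∏_p w^{(V)}(U_p) ∏_b dU_b` of the weight `w`
  (`weightZ_plaqFn : weightZ d L (plaqFn J c) V = torusZtw d L J c V`);
* `centreEven w`, `centreOdd w` — the even and odd parts of `w` under the centre, `w_± (U) = (w(U) ± w(-U))/2`
  (for the character action: `S¹` and `S^{1/2}` of T07 App. A §5, integer vs half-integer spins), with
  `centreEven_negOne_mul`, `centreOdd_negOne_mul` (`w_+(-U) = w_+(U)`, `w_-(-U) = -w_-(U)`).

HONEST FRAMING: finite-volume definitions and algebraic identities only.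
-/

noncomputable section

open MeasureTheory Finset
open scoped BigOperators
open Literature.MathematicalPhysics.QuantumLattice
open Literature.Probability.LatticeModels (IsRConnected)

namespace Literature.MathematicalPhysics.QuantumFieldTheory

namespace Tomboulis2007

variable {d L : ℕ}

/-! ### Even and odd parts of a weight under the centre `{±𝟙}` -/

/-- The centre-even part `w_+(U) = (w(U) + w(-U))/2` of a plaquette weight (for the character action `1 + Σ d_j c_j χ_j`
this is `S¹ = 1 + Σ_{j integer} …`, arXiv:0707.2179 App. A §5). [cite: Tomboulis2007Confinement, App. A §5 eq. (A.17)] -/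
def centreEven (w : SU2 → ℝ) (W : SU2) : ℝ := (w W + w (negOne * W)) / 2

/-- The centre-odd part `w_-(U) = (w(U) - w(-U))/2` (for the character action: `S^{1/2} = Σ_{j half-integer} …`,
arXiv:0707.2179 App. A §5). [cite: Tomboulis2007Confinement, App. A §5 eq. (A.17)] -/
def centreOdd (w : SU2 → ℝ) (W : SU2) : ℝ := (w W - w (negOne * W)) / 2

/-- `w = w_+ + w_-`. [cite: Tomboulis2007Confinement, App. A §5 eq. (A.17)] -/
theorem centreEven_add_centreOdd (w : SU2 → ℝ) (W : SU2) : centreEven w W + centreOdd w W = w W := by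
  unfold centreEven centreOdd; ring

/-- `w(-U) = w_+(U) - w_-(U)`. [cite: Tomboulis2007Confinement, App. A §5 eq. (A.17)] -/
theorem centreEven_sub_centreOdd (w : SU2 → ℝ) (W : SU2) : centreEven w W - centreOdd w W = w (negOne * W) := by
  unfold centreEven centreOdd; ring

/-- `w_+(-U) = w_+(U)` (`(-𝟙)² = 𝟙`). [cite: Tomboulis2007Confinement, §4 eq. (4.4)] -/
theorem centreEven_negOne_mul (w : SU2 → ℝ) (W : SU2) : centreEven w (negOne * W) = centreEven w W := by
  unfold centreEven
  rw [← mul_assoc, negOne_mul_negOne, one_mul]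
  ring

/-- `w_-(-U) = -w_-(U)`. [cite: Tomboulis2007Confinement, §4 eq. (4.4)] -/
theorem centreOdd_negOne_mul (w : SU2 → ℝ) (W : SU2) : centreOdd w (negOne * W) = -centreOdd w W := by
  unfold centreOdd
  rw [← mul_assoc, negOne_mul_negOne, one_mul]
  ring

/-- Under an even power of `-𝟙` the even part is unchanged, and so under any power. [cite: Tomboulis2007Confinement, §4 eq. (4.4)] -/
theorem centreEven_negOne_pow_mul (w : SU2 → ℝ) (k : ℕ) (W : SU2) :
    centreEven w (negOne ^ k * W) = centreEven w W := by
  induction k generalizing W with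
  | zero => simp
  | succ k ih => rw [pow_succ, mul_assoc, ih, centreEven_negOne_mul]

/-- `w_-((-𝟙)^k U) = (-1)^k w_-(U)`. [cite: Tomboulis2007Confinement, §4 eq. (4.4)] -/
theorem centreOdd_negOne_pow_mul (w : SU2 → ℝ) (k : ℕ) (W : SU2) :
    centreOdd w (negOne ^ k * W) = (-1 : ℝ) ^ k * centreOdd w W := by
  induction k generalizing W with
  | zero => simp
  | succ k ih => rw [pow_succ, mul_assoc, ih, centreOdd_negOne_mul, pow_succ]; ring

/-! ### Activities and the twisted partition function of a general weight -/

/-- **The plaquette activity of the weight `w` with centre twist on `V`**: `w(-U_p) - 1` for `p ∈ V`, `w(U_p) - 1`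
otherwise (arXiv:0707.2179 (6.7) with the replacement (4.4) `U_p → -U_p` on the twisted plaquettes).
[cite: Tomboulis2007Confinement, §6.2 eq. (6.7) and §4 eq. (4.4)] -/
def weightActivity (w : SU2 → ℝ) (V : Finset (Plaquette d L)) (U : GaugeConfig d L SU2) (p : Plaquette d L) : ℝ :=
  (if p ∈ V then w (negOne * plaquetteHolonomy U p.1 p.2.1.1 p.2.1.2)
    else w (plaquetteHolonomy U p.1 p.2.1.1 p.2.1.2)) - 1

/-- On the twist set the activity is `w(-U_p) - 1`. [cite: Tomboulis2007Confinement, §4 eq. (4.4)] -/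
theorem weightActivity_of_mem {w : SU2 → ℝ} {V : Finset (Plaquette d L)} {p : Plaquette d L} (hp : p ∈ V)
    (U : GaugeConfig d L SU2) :
    weightActivity w V U p = w (negOne * plaquetteHolonomy U p.1 p.2.1.1 p.2.1.2) - 1 := by
  simp [weightActivity, hp]

/-- Off the twist set the activity is `w(U_p) - 1`. [cite: Tomboulis2007Confinement, §6.2 eq. (6.7)] -/
theorem weightActivity_of_not_mem {w : SU2 → ℝ} {V : Finset (Plaquette d L)} {p : Plaquette d L} (hp : p ∉ V)
    (U : GaugeConfig d L SU2) :
    weightActivity w V U p = w (plaquetteHolonomy U p.1 p.2.1.1 p.2.1.2) - 1 := by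
  simp [weightActivity, hp]

/-- `1 +` activity is the (twisted or untwisted) weight. [cite: Tomboulis2007Confinement, §4 eq. (4.5)] -/
theorem one_add_weightActivity (w : SU2 → ℝ) (V : Finset (Plaquette d L)) (U : GaugeConfig d L SU2) (p : Plaquette d L) :
    1 + weightActivity w V U p =
      (if p ∈ V then w (negOne * plaquetteHolonomy U p.1 p.2.1.1 p.2.1.2)
        else w (plaquetteHolonomy U p.1 p.2.1.1 p.2.1.2)) := by
  unfold weightActivity; ring

/-- The activity splits as `(w_+ - 1) ± w_-`: `+` off the twist set, `-` on it (arXiv:0707.2179 App. A §5: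
`f = S¹ + S^{1/2}`, `f⁻ = S¹ - S^{1/2}`). [cite: Tomboulis2007Confinement, App. A §5 eq. (A.17)] -/
theorem weightActivity_eq_centreEven_add_sign_mul_centreOdd (w : SU2 → ℝ) (V : Finset (Plaquette d L))
    (U : GaugeConfig d L SU2) (p : Plaquette d L) :
    weightActivity w V U p =
      (if p ∈ V then (-1 : ℝ) else 1) * centreOdd w (plaquetteHolonomy U p.1 p.2.1.1 p.2.1.2) +
        (centreEven w (plaquetteHolonomy U p.1 p.2.1.1 p.2.1.2) - 1) := by
  by_cases hp : p ∈ V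
  · rw [weightActivity_of_mem hp, if_pos hp, ← centreEven_sub_centreOdd w (plaquetteHolonomy U p.1 p.2.1.1 p.2.1.2)]
    ring
  · rw [weightActivity_of_not_mem hp, if_neg hp, ← centreEven_add_centreOdd w (plaquetteHolonomy U p.1 p.2.1.1 p.2.1.2)]
    ring

/-- **For the character action the weight activity is Tomboulis's activity**: `plaqFn J c (-U) = plaqFnTwist J c U`
(arXiv:0707.2179 (4.4)). [cite: Tomboulis2007Confinement, §4 eq. (4.4)] -/
theorem weightActivity_plaqFn (J : ℕ) (c : ℕ → ℝ) (V : Finset (Plaquette d L)) (U : GaugeConfig d L SU2)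
    (p : Plaquette d L) : weightActivity (plaqFn J c) V U p = plaqActivity J c V U p := by
  unfold weightActivity plaqActivity
  rw [plaqFn_negOne_mul]

variable [NeZero L]

/-- **The polymer activity of the weight `w`**: `z^{(V)}(X) = ∫ ∏_{p∈X} (w^{(V)}(U_p) - 1) ∏_b dU_b` (complex; `0` unless
`X` is a polymer) (arXiv:0707.2179 eq. (6.6)). [cite: Tomboulis2007Confinement, §6.2 eq. (6.6)] -/
def weightPolymerActivity (w : SU2 → ℝ) (V X : Finset (Plaquette d L)) : ℂ :=
  by classical exact
  if IsRConnected linkRel X then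
    (((∫ U, ∏ p ∈ X, weightActivity w V U p ∂(Measure.pi fun _ : Edge d L => haarProbability SU2)) : ℝ) : ℂ)
  else 0

/-- The activity of a polymer is the Haar integral of the product of its plaquette activities.
[cite: Tomboulis2007Confinement, §6.2 eq. (6.6)] -/
theorem weightPolymerActivity_of_isRConnected {w : SU2 → ℝ} {V X : Finset (Plaquette d L)}
    (hX : IsRConnected linkRel X) :
    weightPolymerActivity w V X =
      (((∫ U, ∏ p ∈ X, weightActivity w V U p ∂(Measure.pi fun _ : Edge d L => haarProbability SU2)) : ℝ) : ℂ) := by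
  classical
  simp [weightPolymerActivity, hX]

/-- Non-polymers carry no activity. [cite: Tomboulis2007Confinement, §6.2 eq. (6.6)] -/
theorem weightPolymerActivity_of_not_isRConnected {w : SU2 → ℝ} {V X : Finset (Plaquette d L)}
    (hX : ¬ IsRConnected linkRel X) : weightPolymerActivity w V X = 0 := by
  classical
  simp [weightPolymerActivity, hX]

/-- For the character action the weight polymer activity is `polymerActivity`. [cite: Tomboulis2007Confinement, §6.2 eq. (6.6)] -/
theorem weightPolymerActivity_plaqFn (J : ℕ) (c : ℕ → ℝ) (V X : Finset (Plaquette d L)) :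
    weightPolymerActivity (plaqFn J c) V X = polymerActivity J c V X := by
  by_cases hX : IsRConnected linkRel X
  · rw [weightPolymerActivity_of_isRConnected hX, polymerActivity_of_isRConnected hX]
    simp_rw [weightActivity_plaqFn]
  · rw [weightPolymerActivity_of_not_isRConnected hX, polymerActivity_of_not_isRConnected hX]

variable (d L) in
/-- **The twisted partition function of the weight `w`** with centre twist on `V`: `∫ ∏_p w^{(V)}(U_p) ∏_b dU_b`
(arXiv:0707.2179 (4.5) for a general weight; for Wilson's weight and `V` the vortex sheet this is 't Hooft's twisted
partition function up to the constant `e^{-2β#plaquettes}`). [cite: Tomboulis2007Confinement, §4 eq. (4.5)] -/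
def weightZ (w : SU2 → ℝ) (V : Finset (Plaquette d L)) : ℝ :=
  ∫ U, ∏ p : Plaquette d L,
      (if p ∈ V then w (negOne * plaquetteHolonomy U p.1 p.2.1.1 p.2.1.2)
        else w (plaquetteHolonomy U p.1 p.2.1.1 p.2.1.2))
    ∂(Measure.pi fun _ : Edge d L => haarProbability SU2)

/-- For the character action `weightZ` is Tomboulis's `Z⁻_V`. [cite: Tomboulis2007Confinement, §4 eq. (4.5)] -/
theorem weightZ_plaqFn (J : ℕ) (c : ℕ → ℝ) (V : Finset (Plaquette d L)) :
    weightZ d L (plaqFn J c) V = torusZtw d L J c V := by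
  unfold weightZ torusZtw
  simp_rw [plaqFn_negOne_mul]

/-- Scaling the weight by a constant scales `weightZ` by its `#plaquettes`-th power (so the vortex ratio is
scale-invariant). [cite: Tomboulis2007Confinement, §6.1 eq. (6.1)] -/
theorem weightZ_const_mul (κ : ℝ) (w : SU2 → ℝ) (V : Finset (Plaquette d L)) :
    weightZ d L (fun W => κ * w W) V = κ ^ Fintype.card (Plaquette d L) * weightZ d L w V := by
  unfold weightZ
  rw [← integral_const_mul]
  congr 1
  funext U
  rw [← Finset.card_univ, ← Finset.prod_const, ← Finset.prod_mul_distrib]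
  refine Finset.prod_congr rfl fun p _ => ?_
  split_ifs <;> rfl

end Tomboulis2007

end Literature.MathematicalPhysics.QuantumFieldTheory

end
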